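import Mathlib
import HarnessLib
import Literature.Analysis.FluidPDE.HelicityDensityPseudoscalar
import Summits.NavierStokesRegularity.NavierStokesRegularity.Theorems.UnthreadedDoorAntidynamoWallAccumulating
import Summits.NavierStokesRegularity.NavierStokesRegularity.Theorems.UnthreadedDoorAntidynamoWallSymmetricPotential
import Summits.NavierStokesRegularity.NavierStokesRegularity.Theorems.UnthreadedDoorAntidynamoWallEvenSectorFarPast

/-!
# Route `UnthreadedDoor` / `ThreadingFlux`, crux `PoloidalLiouville` (stmt-NavierStokesRegularity-1222), antidynamo v2 skeleton
# (sha16 `4ebf5683127b`), WALL `stub_scalarLiouville`: THE TWIN DICHOTOMY — every symmetric / periodic sector collapses to its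
# NS-invariant core AT ALL TIMES

Support file (seat leafhand-ns-unthreadeddoor-2 g1, cell decomp-ns), `--supports stmt-NavierStokesRegularity-1222 --as helper`; theorems only.

A **twin** of the wall's flow `v` is another member `u` of the class (bounded ancient mild, duality form, jointly smooth) with THE SAME VORTICITY at
every `t < 0`.  Conjugates by a symmetry of the vorticity (`u = R v(x₀ + R⁻¹(· − x₀))`, p814882) and time shifts by a period of the vorticity
(`u = v(· − τ)`, p815765) are twins.  This file proves the sector-free statements once and reads the sectors off them:

* `twin_eq_add_drift` — twins differ by the spatial constant `k(t) = u(t,x₀) − v(t,x₀)` (curl- and divergence-free bounded `C²` fields are constant).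
* `fderiv_curl_apply_twinDrift_eq_zero` / `inner_twinDrift_curl_eq_zero` — `Dω(t,x)[k(t)] = 0` (Galilean twins, p814882) and, `v` being unthreaded
  about `x₀`, `⟪k(t), ω(t,x)⟫ = 0` for ALL `t < 0`, `x`.
* ★★★ `curl_eq_zero_or_twinDrift_eq_zero` — **TWIN DICHOTOMY**: EITHER `curl v ≡ 0` on `(−∞,0) × ℝ³` OR `u(t, x₀) = v(t, x₀)` for EVERY `t < 0`
  (if `k(t₁) ≠ 0` at one instant, continuity gives orthogonal directions `k(t)` at times accumulating at `t₁`, and the accumulation closer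
  `curl_eq_zero_of_orthogonal_direction_frequently` (p816144) concludes).
* ★★★ `curl_eq_zero_or_centre_fixed_of_curl_symmetric` — for ANY linear isometry `R`: vorticity `R`-pseudo-symmetric about `x₀` at every `t < 0` ⇒
  irrotational ∨ `R v(t,x₀) = v(t,x₀)` for EVERY `t < 0` (sharpens p814882, which needed `R v(t,x₀) ≠ v(t,x₀)` on a far past);
  the wall's letter `stubScalarLiouville_or_centre_fixed_of_symmetric_potential` for `R`-invariant potentials (sharpens p815345).
* ★★★ `curl_eq_zero_or_centre_periodic_of_curl_periodic` — vorticity `τ`-periodic in time (`τ > 0`; steady vorticity = every `τ`) ⇒ irrotational ∨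
  `v(t − τ, x₀) = v(t, x₀)` for EVERY `t < 0` (sharpens p815765).

MEANING FOR THE WALL (repair census): the residual of every symmetric sector is now EXACTLY its genuinely invariant core at ALL times — the centre
velocity is `R`-fixed for all `t` (rotations: on the axis; reflections: in the mirror; point reflection: zero), resp. `τ`-periodic for all `t`.
HONEST LABEL: corollaries of p816144 + the twin algebra of p814882/p815765; nothing here proves `stub_scalarLiouville`, `PoloidalLiouville` (1222), or
bears on Navier–Stokes regularity; no summit statement is proved (crux 1222 is INCOMPARABLE with the summit). [folklore]
[cite: KochNadirashviliSereginSverak2009, Thm 5.2 (arXiv:0709.3599 pp. 9–10)]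
-/

noncomputable section

-- the summit and its single sub-problem share the name (CONVENTIONS §1)
set_option linter.dupNamespace false

open scoped Topology InnerProductSpace RealInnerProductSpace ContDiff
open Filter Set Function Metric MeasureTheory
open Literature.Analysis.FluidPDE

namespace Summit.NavierStokesRegularity.NavierStokesRegularity.Theorems.PoloidalLiouville.Antidynamo

open Summit.NavierStokesRegularity.NavierStokesRegularity.Theorems.PoloidalLiouville
  (toroidalPotential exists_norm_curl_le constantOfIrrotational vorticityOfClass)

/-! ### Twins differ by a spatial constant -/

/-- **TWINS DIFFER BY THEIR CENTRE DRIFT.**  Two bounded ancient mild solutions (duality class), jointly smooth on `(−∞,0) × ℝ³`, with the same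
vorticity at every `t < 0`, differ by the spatial constant `u(t,x₀) − v(t,x₀)`: the difference is a bounded curl- and divergence-free `C²` field
(`eq_of_curl_eq_zero_of_isDivFree_of_bounded`). [folklore] -/
theorem twin_eq_add_drift
    {v u : ℝ → EuclideanSpace ℝ (Fin 3) → EuclideanSpace ℝ (Fin 3)} (x₀ : EuclideanSpace ℝ (Fin 3))
    (hB : Literature.Analysis.FluidPDE.IsBoundedAncientMildSolution 1 v)
    (hsm : ContDiffOn ℝ (⊤ : ℕ∞) (Function.uncurry v) (Set.Iio 0 ×ˢ Set.univ))
    (hBu : Literature.Analysis.FluidPDE.IsBoundedAncientMildSolution 1 u)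
    (hsmu : ContDiffOn ℝ (⊤ : ℕ∞) (Function.uncurry u) (Set.Iio 0 ×ˢ Set.univ))
    (hcu : ∀ s < 0, ∀ x, curl (u s) x = curl (v s) x) :
    ∀ s < 0, ∀ y, u s y = v s y + (u s x₀ - v s x₀) := by
  have hsm' : IsSmoothSpaceTimeOn (Iio 0) v := hsm
  have hsmu' : IsSmoothSpaceTimeOn (Iio 0) u := hsmu
  obtain ⟨M, hM⟩ := hB.isBoundedOn
  obtain ⟨Mu, hMu⟩ := hBu.isBoundedOn
  intro s hs y
  have hvs : ContDiff ℝ ∞ (v s) := hsm'.contDiff_slice hs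
  have hus : ContDiff ℝ ∞ (u s) := hsmu'.contDiff_slice hs
  have hv2 : ContDiff ℝ 2 (v s) := hvs.of_le (by norm_cast)
  have hu2 : ContDiff ℝ 2 (u s) := hus.of_le (by norm_cast)
  set W : EuclideanSpace ℝ (Fin 3) → EuclideanSpace ℝ (Fin 3) := fun y => u s y - v s y with hW
  have hW2 : ContDiff ℝ 2 W := hu2.sub hv2
  have hud : ∀ y, DifferentiableAt ℝ (u s) y := fun y => (hu2.differentiable (by norm_num)) y
  have hvd : ∀ y, DifferentiableAt ℝ (v s) y := fun y => (hv2.differentiable (by norm_num)) y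
  have hWcurl : ∀ y, curl W y = 0 := fun y => by
    rw [hW, curl_sub (hud y) (hvd y), hcu s hs y, sub_self]
  have hdivv : VectorCalculus.IsDivFree (v s) :=
    (hB.isAncientMildSolution.1 s hs).isDivFree_of_contDiff (hvs.of_le (by norm_cast))
  have hdivu : VectorCalculus.IsDivFree (u s) :=
    (hBu.isAncientMildSolution.1 s hs).isDivFree_of_contDiff (hus.of_le (by norm_cast))
  have hWdiv : VectorCalculus.IsDivFree W := by
    intro y
    have h1 := hdivu y
    have h2 := hdivv y
    simp only [VectorCalculus.divergence] at h1 h2 ⊢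
    rw [hW, fderiv_fun_sub (hud y) (hvd y), ContinuousLinearMap.toLinearMap_sub, map_sub, h1, h2, sub_zero]
  have hWb : ∀ y, ‖W y‖ ≤ Mu + M := fun y => (norm_sub_le _ _).trans (add_le_add (hMu s hs y) (hM s hs y))
  have hWy : W y = W x₀ := eq_of_curl_eq_zero_of_isDivFree_of_bounded hW2 hWcurl hWdiv hWb y x₀
  calc u s y = W y + v s y := by rw [hW, sub_add_cancel]
    _ = v s y + (u s x₀ - v s x₀) := by rw [hWy, hW, add_comm]

/-- **THE VORTICITY IS TRANSLATION-FLAT ALONG THE TWIN DRIFT**: `D(curl v(t))(x)[u(t,x₀) − v(t,x₀)] = 0` for all `t < 0`, `x`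
(`fderiv_curl_apply_eq_zero_of_galileanTwin` through the bridge `vorticityOfClass`). [folklore] -/
theorem fderiv_curl_apply_twinDrift_eq_zero
    {v u : ℝ → EuclideanSpace ℝ (Fin 3) → EuclideanSpace ℝ (Fin 3)} (x₀ : EuclideanSpace ℝ (Fin 3))
    (hB : Literature.Analysis.FluidPDE.IsBoundedAncientMildSolution 1 v)
    (hm : ∀ t < 0, AEStronglyMeasurable (v t) volume)
    (hsm : ContDiffOn ℝ (⊤ : ℕ∞) (Function.uncurry v) (Set.Iio 0 ×ˢ Set.univ))
    (hBu : Literature.Analysis.FluidPDE.IsBoundedAncientMildSolution 1 u)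
    (hmu : ∀ t < 0, AEStronglyMeasurable (u t) volume)
    (hsmu : ContDiffOn ℝ (⊤ : ℕ∞) (Function.uncurry u) (Set.Iio 0 ×ˢ Set.univ))
    (hcu : ∀ s < 0, ∀ x, curl (u s) x = curl (v s) x) {t : ℝ} (ht : t < 0) (x : EuclideanSpace ℝ (Fin 3)) :
    fderiv ℝ (curl (v t)) x (u t x₀ - v t x₀) = 0 := by
  obtain ⟨hV, -⟩ := vorticityOfClass v hB hm hsm
  obtain ⟨hU, -⟩ := vorticityOfClass u hBu hmu hsmu
  exact fderiv_curl_apply_eq_zero_of_galileanTwin hV hU (fun s => u s x₀ - v s x₀)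
    (twin_eq_add_drift x₀ hB hsm hBu hsmu hcu) ht x

/-- **UNTHREADED + TWIN ⇒ THE VORTICITY IS ORTHOGONAL TO THE TWIN DRIFT**: `⟪u(t,x₀) − v(t,x₀), curl v(t,x)⟫ = 0` for all `t < 0`, `x`
(differentiate the tangency identity along the flat direction, `inner_curl_eq_zero_of_fderiv_curl_apply_eq_zero`). [folklore] -/
theorem inner_twinDrift_curl_eq_zero
    {v u : ℝ → EuclideanSpace ℝ (Fin 3) → EuclideanSpace ℝ (Fin 3)} (x₀ : EuclideanSpace ℝ (Fin 3))
    (hB : Literature.Analysis.FluidPDE.IsBoundedAncientMildSolution 1 v)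
    (hm : ∀ t < 0, AEStronglyMeasurable (v t) volume)
    (hsm : ContDiffOn ℝ (⊤ : ℕ∞) (Function.uncurry v) (Set.Iio 0 ×ˢ Set.univ))
    (hun : ∀ t < 0, ∀ x, ⟪x - x₀, curl (v t) x⟫ = 0)
    (hBu : Literature.Analysis.FluidPDE.IsBoundedAncientMildSolution 1 u)
    (hmu : ∀ t < 0, AEStronglyMeasurable (u t) volume)
    (hsmu : ContDiffOn ℝ (⊤ : ℕ∞) (Function.uncurry u) (Set.Iio 0 ×ˢ Set.univ))
    (hcu : ∀ s < 0, ∀ x, curl (u s) x = curl (v s) x) {t : ℝ} (ht : t < 0) (x : EuclideanSpace ℝ (Fin 3)) :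
    ⟪u t x₀ - v t x₀, curl (v t) x⟫ = 0 := by
  have hsm' : IsSmoothSpaceTimeOn (Iio 0) v := hsm
  have hv2 : ContDiff ℝ 2 (v t) := (hsm'.contDiff_slice ht).of_le (by norm_cast)
  exact inner_curl_eq_zero_of_fderiv_curl_apply_eq_zero hv2 x₀ (u t x₀ - v t x₀) (hun t ht)
    (fun y => fderiv_curl_apply_twinDrift_eq_zero x₀ hB hm hsm hBu hmu hsmu hcu ht y) x

/-- Continuity of the centre value `t ↦ w(t, x₀)` at a negative time, for a jointly smooth `w`. [folklore] -/
theorem continuousAt_centre {w : ℝ → EuclideanSpace ℝ (Fin 3) → EuclideanSpace ℝ (Fin 3)} (x₀ : EuclideanSpace ℝ (Fin 3))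
    (hsm : ContDiffOn ℝ (⊤ : ℕ∞) (Function.uncurry w) (Set.Iio 0 ×ˢ Set.univ)) {t₁ : ℝ} (ht₁ : t₁ < 0) :
    ContinuousAt (fun s : ℝ => w s x₀) t₁ := by
  have h1 : ContinuousAt (Function.uncurry w) (t₁, x₀) :=
    hsm.continuousOn.continuousAt ((isOpen_Iio.prod isOpen_univ).mem_nhds ⟨ht₁, mem_univ _⟩)
  have h2 : ContinuousAt (fun s : ℝ => (s, x₀)) t₁ := (continuous_id.prodMk continuous_const).continuousAt
  exact ContinuousAt.comp (f := fun s : ℝ => (s, x₀)) (x := t₁) h1 h2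

/-! ### ★★★ The twin dichotomy -/

/-- ★★★ **TWIN DICHOTOMY.**  Let `v` be a bounded ancient mild solution (`ν = 1`, duality class) with measurable slices, jointly smooth on
`(−∞,0) × ℝ³` and unthreaded about `x₀`, and let `u` be a twin (same class, same vorticity at every `t < 0`).  Then EITHER `curl v ≡ 0` on
`(−∞,0) × ℝ³` OR `u(t, x₀) = v(t, x₀)` for EVERY `t < 0`.  [If `u(t₁,x₀) ≠ v(t₁,x₀)`, continuity makes the drift non-zero near `t₁`; the drifts are
orthogonal directions (`inner_twinDrift_curl_eq_zero`) at times accumulating at `t₁`; the accumulation closer (p816144) concludes.]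
[cite: KochNadirashviliSereginSverak2009, Thm 5.2 (arXiv:0709.3599 pp. 9–10)] -/
theorem curl_eq_zero_or_twinDrift_eq_zero
    {v u : ℝ → EuclideanSpace ℝ (Fin 3) → EuclideanSpace ℝ (Fin 3)} (x₀ : EuclideanSpace ℝ (Fin 3))
    (hB : Literature.Analysis.FluidPDE.IsBoundedAncientMildSolution 1 v)
    (hm : ∀ t < 0, AEStronglyMeasurable (v t) volume)
    (hsm : ContDiffOn ℝ (⊤ : ℕ∞) (Function.uncurry v) (Set.Iio 0 ×ˢ Set.univ))
    (hun : ∀ t < 0, ∀ x, ⟪x - x₀, curl (v t) x⟫ = 0)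
    (hBu : Literature.Analysis.FluidPDE.IsBoundedAncientMildSolution 1 u)
    (hmu : ∀ t < 0, AEStronglyMeasurable (u t) volume)
    (hsmu : ContDiffOn ℝ (⊤ : ℕ∞) (Function.uncurry u) (Set.Iio 0 ×ˢ Set.univ))
    (hcu : ∀ s < 0, ∀ x, curl (u s) x = curl (v s) x) :
    (∀ t < 0, ∀ x, curl (v t) x = 0) ∨ ∀ t < 0, u t x₀ = v t x₀ := by
  by_cases hst : ∀ t < 0, u t x₀ = v t x₀
  · exact Or.inr hst
  · left
    push Not at hst
    obtain ⟨t₁, ht₁, hne⟩ := hst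
    have hcont : ContinuousAt (fun s : ℝ => u s x₀ - v s x₀) t₁ :=
      (continuousAt_centre x₀ hsmu ht₁).sub (continuousAt_centre x₀ hsm ht₁)
    have hne' : ∀ᶠ s in 𝓝 t₁, u s x₀ - v s x₀ ≠ 0 := hcont.eventually_ne (sub_ne_zero.2 hne)
    have hneg : ∀ᶠ s in 𝓝 t₁, s < 0 := Iio_mem_nhds ht₁
    refine curl_eq_zero_of_orthogonal_direction_frequently v x₀ hB hm hsm hun ⟨t₁, ht₁, ?_⟩
    have h3 : ∀ᶠ s in 𝓝[≠] t₁, ∃ e : EuclideanSpace ℝ (Fin 3), e ≠ 0 ∧ ∀ x, ⟪e, curl (v s) x⟫ = 0 :=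
      ((hne'.and hneg).mono fun s ⟨hs, hs0⟩ =>
        ⟨u s x₀ - v s x₀, hs, fun x => inner_twinDrift_curl_eq_zero x₀ hB hm hsm hun hBu hmu hsmu hcu hs0 x⟩).filter_mono
        nhdsWithin_le_nhds
    exact h3.frequently

/-! ### ★★★ Symmetric sectors: irrotational, or the centre velocity is fixed by the symmetry at all times -/

/-- ★★★ **PSEUDO-SYMMETRIC VORTICITY ⇒ IRROTATIONAL OR `R`-FIXED CENTRE VELOCITY AT ALL TIMES.**  Let `v` be a bounded ancient mild solution
(`ν = 1`, duality class) with measurable slices, jointly smooth on `(−∞,0) × ℝ³`, unthreaded about `x₀`, and `R` a linear isometry of `ℝ³` under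
which the vorticity is symmetric as a pseudovector about `x₀` at every `t < 0`: `curl v(t)(x₀ + R y) = det R • R (curl v(t)(x₀ + y))`.  Then EITHER
`curl v ≡ 0` on `(−∞,0) × ℝ³` OR `R v(t, x₀) = v(t, x₀)` for EVERY `t < 0` (rotations: the centre velocity is on the axis; reflections: in the
mirror; the point reflection `R = −1`: the centre stagnates — at all times).  [The conjugate `u(t,x) = R v(t, x₀ + R⁻¹(x − x₀))` is a twin
(`CellFlux.isBoundedAncientMildSolution_frame`, `curl_conj_rigidMotion`); twin dichotomy.] [cite: KochNadirashviliSereginSverak2009, Thm 5.2 (arXiv:0709.3599 pp. 9–10)] -/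
theorem curl_eq_zero_or_centre_fixed_of_curl_symmetric
    (v : ℝ → EuclideanSpace ℝ (Fin 3) → EuclideanSpace ℝ (Fin 3)) (x₀ : EuclideanSpace ℝ (Fin 3))
    (hB : Literature.Analysis.FluidPDE.IsBoundedAncientMildSolution 1 v)
    (hm : ∀ t < 0, AEStronglyMeasurable (v t) volume)
    (hsm : ContDiffOn ℝ (⊤ : ℕ∞) (Function.uncurry v) (Set.Iio 0 ×ˢ Set.univ))
    (hun : ∀ t < 0, ∀ x, ⟪x - x₀, curl (v t) x⟫ = 0)
    (R : EuclideanSpace ℝ (Fin 3) ≃ₗᵢ[ℝ] EuclideanSpace ℝ (Fin 3))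
    (hsym : ∀ t < 0, ∀ y, curl (v t) (x₀ + R y) =
      (R : EuclideanSpace ℝ (Fin 3) →L[ℝ] EuclideanSpace ℝ (Fin 3)).det • R (curl (v t) (x₀ + y))) :
    (∀ t < 0, ∀ x, curl (v t) x = 0) ∨ ∀ t < 0, R (v t x₀) = v t x₀ := by
  have hsm' : IsSmoothSpaceTimeOn (Iio 0) v := hsm
  -- the conjugated field `u(t, x) = R v(t, x₀ + R⁻¹ (x − x₀)) = R v(t, R⁻¹ x + c)` (as in p814882)
  set c : EuclideanSpace ℝ (Fin 3) := x₀ - R.symm x₀ with hc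
  set u : ℝ → EuclideanSpace ℝ (Fin 3) → EuclideanSpace ℝ (Fin 3) := fun s y => R (v s (R.symm y + c)) with hu
  have hBu : Literature.Analysis.FluidPDE.IsBoundedAncientMildSolution 1 u := by
    have h := CellFlux.isBoundedAncientMildSolution_frame hB R c (le_refl (0 : ℝ))
    have e : (fun s y => R (v (s + 0) (R.symm y + c))) = u := by
      funext s y
      rw [add_zero]
    rw [e] at h
    exact h
  have hus : ∀ s < 0, ContDiff ℝ ∞ (u s) := fun s hs =>
    R.contDiff.comp ((hsm'.contDiff_slice hs).comp (R.symm.contDiff.add contDiff_const))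
  have hmu : ∀ s < 0, AEStronglyMeasurable (u s) volume := fun s hs => (hus s hs).continuous.aestronglyMeasurable
  have hsmu : ContDiffOn ℝ (⊤ : ℕ∞) (Function.uncurry u) (Set.Iio 0 ×ˢ Set.univ) := by
    have hmap : ContDiff ℝ (⊤ : ℕ∞) fun p : ℝ × EuclideanSpace ℝ (Fin 3) => (p.1, R.symm p.2 + c) :=
      contDiff_fst.prodMk ((R.symm.contDiff.comp contDiff_snd).add contDiff_const)
    have hmaps : MapsTo (fun p : ℝ × EuclideanSpace ℝ (Fin 3) => (p.1, R.symm p.2 + c)) (Iio 0 ×ˢ univ) (Iio 0 ×ˢ univ) :=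
      fun p hp => ⟨hp.1, mem_univ _⟩
    exact R.contDiff.comp_contDiffOn (hsm.comp hmap.contDiffOn hmaps)
  -- the same vorticity
  have hcu : ∀ s < 0, ∀ x, curl (u s) x = curl (v s) x := by
    intro s hs x
    rw [hu, curl_conj_rigidMotion R c (v s) x]
    have e1 : R.symm x + c = x₀ + R.symm (x - x₀) := by
      rw [hc, map_sub]
      abel
    rw [e1, ← hsym s hs (R.symm (x - x₀)), LinearIsometryEquiv.apply_symm_apply, add_sub_cancel]
  have hux0 : ∀ s, u s x₀ = R (v s x₀) := by
    intro s
    simp only [hu, hc, add_sub_cancel]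
  rcases curl_eq_zero_or_twinDrift_eq_zero x₀ hB hm hsm hun hBu hmu hsmu hcu with h | h
  · exact Or.inl h
  · exact Or.inr fun t ht => by rw [← hux0 t]; exact h t ht

/-- ★★★ **… HENCE: SLICE-WISE CONSTANT, OR `R`-FIXED CENTRE VELOCITY AT ALL TIMES.** [cite: KochNadirashviliSereginSverak2009, Thm 5.2 (arXiv:0709.3599 pp. 9–10)] -/
theorem constant_or_centre_fixed_of_curl_symmetric
    (v : ℝ → EuclideanSpace ℝ (Fin 3) → EuclideanSpace ℝ (Fin 3)) (x₀ : EuclideanSpace ℝ (Fin 3))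
    (hB : Literature.Analysis.FluidPDE.IsBoundedAncientMildSolution 1 v)
    (hm : ∀ t < 0, AEStronglyMeasurable (v t) volume)
    (hsm : ContDiffOn ℝ (⊤ : ℕ∞) (Function.uncurry v) (Set.Iio 0 ×ˢ Set.univ))
    (hun : ∀ t < 0, ∀ x, ⟪x - x₀, curl (v t) x⟫ = 0)
    (R : EuclideanSpace ℝ (Fin 3) ≃ₗᵢ[ℝ] EuclideanSpace ℝ (Fin 3))
    (hsym : ∀ t < 0, ∀ y, curl (v t) (x₀ + R y) =
      (R : EuclideanSpace ℝ (Fin 3) →L[ℝ] EuclideanSpace ℝ (Fin 3)).det • R (curl (v t) (x₀ + y))) :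
    (∀ t < 0, ∃ b : EuclideanSpace ℝ (Fin 3), ∀ x, v t x = b) ∨ ∀ t < 0, R (v t x₀) = v t x₀ := by
  rcases curl_eq_zero_or_centre_fixed_of_curl_symmetric v x₀ hB hm hsm hun R hsym with h | h
  · exact Or.inl (constantOfIrrotational v hB hsm h)
  · exact Or.inr h

/-- ★★★ **THE WALL'S LETTER ON `R`-INVARIANT POTENTIALS: TRIVIAL, OR `R`-FIXED CENTRE VELOCITY AT ALL TIMES.**  If the vorticity of the wall's
flow is `∇T(t,·) × (· − x₀)` with `T(t, x₀ + R y) = T(t, x₀ + y)` for all `t < 0`, `y` (a linear isometry `R`: even, `Cₙ`-, mirror-,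
polyhedrally-symmetric potentials), then EITHER `∇T × (x − x₀) ≡ 0` on `(−∞,0) × ℝ³` OR `R v(t,x₀) = v(t,x₀)` for EVERY `t < 0`.
[cite: KochNadirashviliSereginSverak2009, Thm 5.2 (arXiv:0709.3599 pp. 9–10)] -/
theorem stubScalarLiouville_or_centre_fixed_of_symmetric_potential
    (v : ℝ → EuclideanSpace ℝ (Fin 3) → EuclideanSpace ℝ (Fin 3)) (x₀ : EuclideanSpace ℝ (Fin 3))
    (T : ℝ → EuclideanSpace ℝ (Fin 3) → ℝ)
    (hB : Literature.Analysis.FluidPDE.IsBoundedAncientMildSolution 1 v)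
    (hm : ∀ t < 0, AEStronglyMeasurable (v t) volume)
    (hsm : ContDiffOn ℝ (⊤ : ℕ∞) (Function.uncurry v) (Set.Iio 0 ×ˢ Set.univ))
    (hrep : ∀ t < 0, ∀ x, Literature.Analysis.FluidPDE.curl (v t) x =
      Literature.Analysis.FluidPDE.cross (gradient (T t) x) (x - x₀))
    (R : EuclideanSpace ℝ (Fin 3) ≃ₗᵢ[ℝ] EuclideanSpace ℝ (Fin 3))
    (hT : ∀ t < 0, ∀ y, T t (x₀ + R y) = T t (x₀ + y)) :
    (∀ t < 0, ∀ x, Literature.Analysis.FluidPDE.cross (gradient (T t) x) (x - x₀) = 0) ∨ ∀ t < 0, R (v t x₀) = v t x₀ := by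
  have hun : ∀ t < 0, ∀ x, ⟪x - x₀, curl (v t) x⟫ = 0 := fun t ht x => by
    rw [hrep t ht x]
    simp [cross, crossProduct, PiLp.inner_apply, Fin.sum_univ_three]
    ring
  have hsym : ∀ t < 0, ∀ y, curl (v t) (x₀ + R y) =
      (R : EuclideanSpace ℝ (Fin 3) →L[ℝ] EuclideanSpace ℝ (Fin 3)).det • R (curl (v t) (x₀ + y)) :=
    fun t ht y => curl_symmetric_of_symmetric_potential (hrep t ht) R (hT t ht) y
  rcases curl_eq_zero_or_centre_fixed_of_curl_symmetric v x₀ hB hm hsm hun R hsym with h | h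
  · exact Or.inl fun t ht x => by rw [← hrep t ht x]; exact h t ht x
  · exact Or.inr h

/-! ### ★★★ Time-periodic (and steady) vorticity: irrotational, or the centre velocity is periodic at all times -/

/-- ★★★ **TIME-PERIODIC VORTICITY ⇒ IRROTATIONAL OR `τ`-PERIODIC CENTRE VELOCITY AT ALL TIMES.**  Let `v` be a bounded ancient mild solution
(`ν = 1`, duality class) with measurable slices, jointly smooth on `(−∞,0) × ℝ³`, unthreaded about `x₀`, whose vorticity is `τ`-periodic in time
(`τ > 0`; a steady vorticity is `τ`-periodic for every `τ`): `curl v(t − τ) = curl v(t)` for all `t < 0`.  Then EITHER `curl v ≡ 0` on `(−∞,0) × ℝ³`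
OR `v(t − τ, x₀) = v(t, x₀)` for EVERY `t < 0`.  [The time shift `u = v(· − τ)` is a twin (`timeShift_class`); twin dichotomy.]
[cite: KochNadirashviliSereginSverak2009, Thm 5.2 (arXiv:0709.3599 pp. 9–10)] -/
theorem curl_eq_zero_or_centre_periodic_of_curl_periodic
    (v : ℝ → EuclideanSpace ℝ (Fin 3) → EuclideanSpace ℝ (Fin 3)) (x₀ : EuclideanSpace ℝ (Fin 3))
    (hB : Literature.Analysis.FluidPDE.IsBoundedAncientMildSolution 1 v)
    (hm : ∀ t < 0, AEStronglyMeasurable (v t) volume)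
    (hsm : ContDiffOn ℝ (⊤ : ℕ∞) (Function.uncurry v) (Set.Iio 0 ×ˢ Set.univ))
    (hun : ∀ t < 0, ∀ x, ⟪x - x₀, curl (v t) x⟫ = 0)
    {τ : ℝ} (hτ : 0 < τ) (hper : ∀ t < 0, ∀ x, curl (v (t - τ)) x = curl (v t) x) :
    (∀ t < 0, ∀ x, curl (v t) x = 0) ∨ ∀ t < 0, v (t - τ) x₀ = v t x₀ := by
  obtain ⟨hBu, hmu, hsmu⟩ := timeShift_class hB hm hsm (show -τ ≤ 0 by linarith)
  have hsub : ∀ s : ℝ, s + -τ = s - τ := fun s => by ring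
  have hcu : ∀ s < 0, ∀ x, curl ((fun s y => v (s + -τ) y) s) x = curl (v s) x := fun s hs x => by
    show curl (v (s + -τ)) x = curl (v s) x
    rw [hsub]
    exact hper s hs x
  rcases curl_eq_zero_or_twinDrift_eq_zero x₀ hB hm hsm hun hBu hmu hsmu hcu with h | h
  · exact Or.inl h
  · exact Or.inr fun t ht => by
      have h1 := h t ht
      simp only [hsub] at h1
      exact h1

/-- ★★★ **… HENCE: SLICE-WISE CONSTANT, OR `τ`-PERIODIC CENTRE VELOCITY AT ALL TIMES.** [cite: KochNadirashviliSereginSverak2009, Thm 5.2 (arXiv:0709.3599 pp. 9–10)] -/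
theorem constant_or_centre_periodic_of_curl_periodic
    (v : ℝ → EuclideanSpace ℝ (Fin 3) → EuclideanSpace ℝ (Fin 3)) (x₀ : EuclideanSpace ℝ (Fin 3))
    (hB : Literature.Analysis.FluidPDE.IsBoundedAncientMildSolution 1 v)
    (hm : ∀ t < 0, AEStronglyMeasurable (v t) volume)
    (hsm : ContDiffOn ℝ (⊤ : ℕ∞) (Function.uncurry v) (Set.Iio 0 ×ˢ Set.univ))
    (hun : ∀ t < 0, ∀ x, ⟪x - x₀, curl (v t) x⟫ = 0)
    {τ : ℝ} (hτ : 0 < τ) (hper : ∀ t < 0, ∀ x, curl (v (t - τ)) x = curl (v t) x) :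
    (∀ t < 0, ∃ b : EuclideanSpace ℝ (Fin 3), ∀ x, v t x = b) ∨ ∀ t < 0, v (t - τ) x₀ = v t x₀ := by
  rcases curl_eq_zero_or_centre_periodic_of_curl_periodic v x₀ hB hm hsm hun hτ hper with h | h
  · exact Or.inl (constantOfIrrotational v hB hsm h)
  · exact Or.inr h

end Summit.NavierStokesRegularity.NavierStokesRegularity.Theorems.PoloidalLiouville.Antidynamo

end
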